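import Mathlib
import HarnessLib
import Summits.NavierStokesRegularity.NavierStokesRegularity.Theses.PoloidalWindowDoor
import Summits.NavierStokesRegularity.NavierStokesRegularity.Theorems.PoloidalWindowDoorLrcModEntireFarThreadReduction
import Summits.NavierStokesRegularity.NavierStokesRegularity.Theorems.PoloidalWindowDoorLrcModEntireFarThreadSplit

/-!
# SKELETON `isolated_thread` v1 — crux `PoloidalWindowRigidity` (K2, stmt-NavierStokesRegularity-19708; concludes ALSO the promoted item
# `LrcModEntire`, stmt-NavierStokesRegularity-20428), route `PoloidalWindowDoor`, THICK column AT THE THREADED HOT SPOT — ideator seat ns-idea-8 gen 5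
# (lens «barrier» = barrier-inversion; files-only per KEY-NS #68/#69: NOT the skeleton of record; the K2 leads decide adoption).

LEVER (five words): **analytic curve selection replaces pins.**

BARRIER INVERTED.  The THICK column of record is S3 = `stub_threadedThickEmpty` (twist_split v5 / far_thread v4: no hot-spot-normalised poloidal
class profile carries non-degenerate twisting THICK windows accumulating at the hot spot `(−1,0)`).  Its LOCAL attack is exhausted: every free jet
datum at the hot spot through order 2 in `(t,x)` and through EVERY order along a flat direction is typed (PINSHEET-g10; `…ThreadQuarticPin`,
`…HigherOrderMaxTest.threadLinePin`) and explicit exact unsteady 13-jets satisfying all of them exist (THREAD-CENSUS-g10 v2, refuter1 K-131):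
«S3 is CLASS-level».  The Hessian split of record (v6 candidate `threadedThick_of_flat_of_morse`: FLAT ∧ MORSE) then descends without end —
Morse → quartic-nondegenerate (`quarticMax`, `flatHotSpotLeafPackage`) → doubly-degenerate residue with «only sixth-order pins, untooled»
(THICK-COLUMN-g10 §4(b)) → eighth order → …: a finite-jet technique class, and the census says the class is void.  The precisely-typed statement
JUST OUTSIDE that class is the one property of the hot spot NO finite jet detects (`y₁² + y₀^{2m}` and `y₁²` share their `(2m−1)`-jet for every
`m`): whether `0` is an ISOLATED point of the top level set `{y ∈ plane : v₂(−1,y) = v₂(−1,0)}`.  Real-analyticity of class profiles decides the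
alternative by a NAMED theorem — the CURVE SELECTION LEMMA (Milnor, Singular points of complex hypersurfaces §3; Łojasiewicz/Bruhat–Cartan for
real-analytic sets): either the hot spot is an isolated critical point of the planar restriction `y ↦ v₂(−1,(y₀,y₁,0))` (`stub_threadCurveSelection`,
first disjunct — it covers Morse, quartic, and EVERY finite-order case at once, with no order-by-order package), or a half-arc `Γ` of the critical
set leaves the hot spot, and `v₂(−1,·) ≡ v₂(−1,0)` along it: an ARC OF HOT SPOTS (second disjunct; every point of `Γ` inherits all pins).
* ISOLATED thread (`stub_isolatedThreadEmpty`, deciding): the superlevel sets `{v₂(t,·,z) ≥ c} ∩ B_δ` near the top are COMPACT INSIDE the ball and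
  free of critical points other than the thread, so (i) every near-top leaf `{v₂ = c} ∩ {x₂ = z}` is a regular real-analytic closed vortex line around
  the thread (no Morse lemma, no radial graphs, no `27B² < 8AQ`), and (ii) the DISC-MOMENT CALCULUS of far_thread/thread_axis is available with
  vanishing boundary terms for ANY leaf topology inside the ball: `𝒜(c) = |{v₂ > c}|`, `T = −𝒜'(c) = ∮ ds/|∇ₕv₂|`, `J = ∮ (∂_z v₂)²/|∇ₕv₂| ds`,
  the exact transport identity `∫_{v₂>c} vₕ·∇ₕv₂ = ½∂_z∫_{v₂>c}(v₂−c)²` (from `uₕ = ∇ₕφ`, `Δₕφ = −∂_z v₂`), the twist slack `J·T ≥ 𝒜_z²`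
  (equality iff the leaf is untwisted) and the disc-integrated vertical momentum with the signed pressure pin `v₂∂_z p ≤ −v₂²/2` at the thread
  (`…ThreadPressure`).  The research content is the class-level closing of that moment system — the SAME named wall as thread_axis on the Morse
  branch (orbital-frequency growth, S6G ≤ `LoopPeriodRatchet.PeriodRatchet`), now stated ONCE for all leaf shapes.
* ARC of hot spots (`stub_hotArcEmpty`, residue, NEW OBJECT): along `Γ` the leaves are open BANDS flanking `Γ` (no closed leaf, no disc moments —
  exactly why the engine above cannot see this case), `Γ` is itself a horizontal vortex line or a zero of `ω`, and in Fermi coordinates `(σ,n)`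
  along `Γ` the twist of the flanking bands is `−2a^{3/2} n² ∂_σ(b/√a) + O(n³)` with `a = −½D²v₂[ν,ν]`, `b = D²v₂[ν,e₂]` read off the hot-spot
  Hessians along `Γ` (`b² ≤ 2a·(−∂_z²v₂)` by the signed Hessian pin): twisting thick windows accumulate at the thread iff `b/√a` is not locally
  constant on `Γ`.  The arc is the exact interpolant between the generic isolated thread and stratum (A) (vorticity invariant under a horizontal
  translation ⇒ a LINE of hot spots; no thick twisting member by STRATUM-A-K2p4 THEOREM A-THICK): the statement just outside Theorem A's class.
SHARED: the (TH)∩twisting column is the registered local stub `stub_localTHEmptyHypNUGRS` VERBATIM (twist_split v4.3/v5, decider j301374), consumed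
through the tree chain exactly as in `…FarThreadReduction.lrcModEntire_of_NUGRS_of_threadedThick`.

COMPOSITION (kernel-checked, no sorry outside `stub_*`): `threadedThickEmpty_of_isolatedThread : I1 → I2 → I3 → S3` (S3 = `stub_threadedThickEmpty`
VERBATIM, by cases on the curve-selection alternative) ⇒ `LrcModEntire_of_isolatedThread : …Theses.PoloidalWindowDoor.LrcModEntire` (tree p633507
`lrcModEntire_of_NUGRS_of_threadedThick`) and `PoloidalWindowRigidity_of_isolatedThread : …Theses.PoloidalWindowDoor.PoloidalWindowRigidity` (tree
`poloidalWindowRigidity_of_TH_of_threadedThick` ∘ the v4.3 local chain).  The v6 Hessian split is NOT used: Morse, quartic-nondegenerate and every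
finite-order flat hot spot all sit inside the first disjunct.

WHAT THIS IS NOT: not a proof of Navier–Stokes regularity, of K2, of item 20428 or of the THICK column — a typed line with ONE deciding research stub
(`stub_isolatedThreadEmpty`, wall named), ONE residue stub on a new object (`stub_hotArcEmpty`), ONE provable named-theorem stub (`stub_threadCurveSelection`,
M: class ⇒ real-analytic slice ⇒ curve selection) and the shared registered (TH) stub.  (M) and the Type-I class are kept in every class-level stub
(honours `Negative.poloidalWindowRigidity_false_without_mild`, K-47 `twisting_false_without_mild`, K-48/K-50 thick kinematic witnesses: none is
hot-spot-normalised in the class).  bears_on LADDER-NS N0 (rung N0-LocalTubeDoorPoloidal), items 19708 / 20428.  No summit is proved by any line.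
-/

noncomputable section

set_option linter.dupNamespace false
set_option linter.unusedVariables false

namespace Summit.NavierStokesRegularity.NavierStokesRegularity.Cruxes.PoloidalWindowRigidity.IsolatedThread

open MeasureTheory Set Function Filter Topology Metric
open scoped RealInnerProductSpace InnerProductSpace Laplacian
open Literature.Analysis Literature.Analysis.FluidPDE
open Summit.NavierStokesRegularity.NavierStokesRegularity.Theses.PoloidalWindowDoor
open Summit.NavierStokesRegularity.NavierStokesRegularity.Theorems.PoloidalWindowDoorLrcModEntireTwistingTHLocalHypGerm
open Summit.NavierStokesRegularity.NavierStokesRegularity.Theorems.PoloidalWindowDoorLrcModEntireTwistingTHLocalNonUmbilic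
open Summit.NavierStokesRegularity.NavierStokesRegularity.Theorems.PoloidalWindowDoorLrcModEntireTwistingTHLocalGalilean
open Summit.NavierStokesRegularity.NavierStokesRegularity.Theorems.PoloidalWindowDoorLrcModEntireTwistingTHLocalNormalFormRS
open Summit.NavierStokesRegularity.NavierStokesRegularity.Theorems.PoloidalWindowDoorLrcModEntireFarThreadReduction

/-! ## The stubs -/

/-- **SHARED STUB ((TH) column) — VERBATIM `stub_localTHEmptyHypNUGRS` of the skeleton of record `Cruxes/LrcModEntire/Lines/twist_split.lean`
v4.3/v5 (ns-poloidal-K2-p3; item stmt-NavierStokesRegularity-20428; decider j301374).**  The local hyperbolic (TH)∩twisting PDE system is empty at a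
non-umbilic rest point in the rotation/scaling gauge.  One landing closes it here and there. -/
theorem stub_localTHEmptyHypNUGRS :
    ∀ (u : ℝ → EuclideanSpace ℝ (Fin 3) → EuclideanSpace ℝ (Fin 3)) (μ A : ℝ → ℝ → ℝ)
      (U : Set (ℝ × EuclideanSpace ℝ (Fin 3))) (p₀ : ℝ × EuclideanSpace ℝ (Fin 3)),
      IsOpen U → p₀ ∈ U →
      AnalyticOnNhd ℝ (Function.uncurry u) U →
      (∀ p ∈ U, AnalyticAt ℝ (Function.uncurry μ) (p.1, p.2 2)) →
      (∀ p ∈ U, AnalyticAt ℝ (Function.uncurry A) (p.1, p.2 2)) →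
      (∀ p ∈ U, fderiv ℝ (u p.1) p.2 (EuclideanSpace.single 0 1) 1 = fderiv ℝ (u p.1) p.2 (EuclideanSpace.single 1 1) 0) →
      (∀ p ∈ U, fderiv ℝ (u p.1) p.2 (EuclideanSpace.single 0 1) 0 + fderiv ℝ (u p.1) p.2 (EuclideanSpace.single 1 1) 1 +
        fderiv ℝ (u p.1) p.2 (EuclideanSpace.single 2 1) 2 = 0) →
      (∀ p ∈ U, ∀ b : Fin 3, b ≠ 2 →
        fderiv ℝ (u p.1) p.2 (EuclideanSpace.single 2 1) b =
          μ p.1 (p.2 2) * fderiv ℝ (u p.1) p.2 (EuclideanSpace.single b 1) 2) →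
      (∀ p ∈ U,
        (1 - μ p.1 (p.2 2)) *
            (deriv (fun s => u s p.2 2) p.1 + fderiv ℝ (fun y => u p.1 y 2) p.2 (u p.1 p.2)
              - Δ (fun y => u p.1 y 2) p.2) =
          A p.1 (p.2 2) + (deriv (fun s => μ s (p.2 2)) p.1 - deriv (deriv (μ p.1)) (p.2 2)) * u p.1 p.2 2
            + deriv (μ p.1) (p.2 2) / 2 * u p.1 p.2 2 ^ 2
            - 2 * deriv (μ p.1) (p.2 2) * fderiv ℝ (u p.1) p.2 (EuclideanSpace.single 2 1) 2) →
      fderiv ℝ (fun y => fderiv ℝ (u p₀.1) y (EuclideanSpace.single 2 1) 2) p₀.2 (EuclideanSpace.single 0 1) *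
            fderiv ℝ (u p₀.1) p₀.2 (EuclideanSpace.single 1 1) 2 -
          fderiv ℝ (fun y => fderiv ℝ (u p₀.1) y (EuclideanSpace.single 2 1) 2) p₀.2 (EuclideanSpace.single 1 1) *
            fderiv ℝ (u p₀.1) p₀.2 (EuclideanSpace.single 0 1) 2 ≠ 0 →
      μ p₀.1 (p₀.2 2) ≠ 0 → μ p₀.1 (p₀.2 2) ≠ 1 → deriv (μ p₀.1) (p₀.2 2) ≠ 0 →
      μ p₀.1 (p₀.2 2) < 0 →
      (fderiv ℝ (u p₀.1) p₀.2 (EuclideanSpace.single 0 1) 0 ≠ fderiv ℝ (u p₀.1) p₀.2 (EuclideanSpace.single 1 1) 1 ∨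
        fderiv ℝ (u p₀.1) p₀.2 (EuclideanSpace.single 1 1) 0 ≠ 0) →
      u p₀.1 p₀.2 = 0 → 
      fderiv ℝ (u p₀.1) p₀.2 (EuclideanSpace.single 0 1) 2 = 0 →
      fderiv ℝ (u p₀.1) p₀.2 (EuclideanSpace.single 1 1) 2 = 1 → False := by
  sorry

/-- **STUB I1 (provable, M): CURVE SELECTION AT THE HOT SPOT.**  For a poloidal class profile whose scale-invariant vertical size
`√(−t)|v₂|` attains its supremum at `(−1,0)`, the planar restriction `f(y₀,y₁) := v₂(−1,(y₀,y₁,0))` is real-analytic (Type-I ancient mild ⇒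
space-analytic slices: KNSS derivative bounds `‖∇ᵏv(s)‖∞ ≤ C_k C^{k+1}(−s)^{−(1+k)/2}` with factorial control, crux workfile `TypeIAnalytic.lean`) and
has a global maximum of `|f|` at `0`.  EITHER `0` is an isolated point of the critical set of `f` (first disjunct: no horizontal critical point in a
punctured planar disc), OR it is not, and then the CURVE SELECTION LEMMA for the real-analytic set `Crit(f) = {∂₀f = ∂₁f = 0}` (Milnor 1968 §3,
Lemma 3.1; Łojasiewicz 1965 §18) gives a continuous injective half-arc `γ : [0,∞) → Crit(f)`, `γ(0) = 0`, real-analytic in a Puiseux parameter, along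
which `(f∘γ)' = ⟪∇f(γ), γ'⟫ = 0`, so `f∘γ ≡ f(0)`: an arc of top-level points (second disjunct).  Why it might fail: only through the analyticity
input (the stub is false for `C^∞` profiles: flat bumps); Mathlib has no curve selection lemma (L-sized to formalise; M on paper). -/
theorem stub_threadCurveSelection :
    ∀ (C : ℝ) (v : ℝ → EuclideanSpace ℝ (Fin 3) → EuclideanSpace ℝ (Fin 3)),
      Literature.Analysis.FluidPDE.HasTypeITimeDecay C v →
      ContinuousOn (Function.uncurry v) (Set.Iio (0 : ℝ) ×ˢ Set.univ) →
      (∀ s t : ℝ, s < t → t < 0 → ∀ x, v t x =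
        Literature.Analysis.UnboundedOperators.heatExtension (v s) (t - s) x -
          Literature.Analysis.FluidPDE.oseenDuhamel 1 s v v t x) →
      (∀ t < 0, Literature.Analysis.FluidPDE.VectorCalculus.IsDivFree (v t)) →
      (∀ s < 0, ∀ y, ⟪Literature.Analysis.FluidPDE.curl (v s) y, EuclideanSpace.single 2 1⟫_ℝ = 0) →
      v (-1) 0 2 ≠ 0 → (∀ t < 0, ∀ x, Real.sqrt (-t) * |v t x 2| ≤ |v (-1) 0 2|) →
      (∃ δ : ℝ, 0 < δ ∧ ∀ y : EuclideanSpace ℝ (Fin 3), y 2 = 0 → y ≠ 0 → ‖y‖ < δ →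
          (fderiv ℝ (v (-1)) y (EuclideanSpace.single 0 1) 2 ≠ 0 ∨ fderiv ℝ (v (-1)) y (EuclideanSpace.single 1 1) 2 ≠ 0)) ∨
      (∃ γ : ℝ → EuclideanSpace ℝ (Fin 3), ContinuousOn γ (Set.Ici 0) ∧ Set.InjOn γ (Set.Ici 0) ∧ γ 0 = 0 ∧
          ∀ σ : ℝ, 0 ≤ σ → (γ σ 2 = 0 ∧ v (-1) (γ σ) 2 = v (-1) 0 2)) := by
  sorry

/-- **STUB I2 (deciding, research; the wall is NAMED): NO ISOLATED TWISTING-THICK THREAD.**  `stub_threadedThickEmpty` VERBATIM plus the first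
curve-selection alternative: the hot spot is an isolated horizontal critical point of `v₂(−1,·)` on its plane.  What the extra hypothesis buys
(and what fails without it — see `stub_hotArcEmpty`): for `c` near the top value the superlevel sets `{y : y₂ = z, |y| < δ, v₂(t,y) ≥ c}` are
compact INSIDE the ball and carry no critical point but the thread, so every near-top leaf is a regular closed real-analytic vortex line around the
thread (Morse, quartic `…QuarticMax`/`…ThreadFlatLeafPackage`, and every finite-order flat case at once — no `27B² < 8AQ`, no radial graphs), and
the disc-moment identities hold with ZERO boundary terms whatever the leaf shape: `𝒜(c)`, `T = −𝒜'`, `J = ∮(∂_z v₂)²/|∇ₕv₂|`, transport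
`∫_{v₂>c} vₕ·∇ₕv₂ = ½∂_z∫_{v₂>c}(v₂−c)²`, twist slack `J·T ≥ 𝒜_z²`, disc-integrated vertical momentum with the signed pin `v₂∂_z p ≤ −v₂²/2`
(`…ThreadPressure`) and `∂ₜv₂ = v₂/2` at the thread.  Research content = the class-level closing of that moment system against the Type-I budget:
the same named wall as thread_axis's Morse branch (orbital-frequency growth S6G ≤ `LoopPeriodRatchet.PeriodRatchet`), stated once for all leaf
shapes.  Why it might fail: the moment system may be as under-determined as the jets (one new structure function per identity); no local
witness can decide it (THREAD-CENSUS-g10: S3 is class-level). -/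
theorem stub_isolatedThreadEmpty :
    ∀ (C : ℝ) (v : ℝ → EuclideanSpace ℝ (Fin 3) → EuclideanSpace ℝ (Fin 3)),
      Literature.Analysis.FluidPDE.HasTypeITimeDecay C v →
      ContinuousOn (Function.uncurry v) (Set.Iio (0 : ℝ) ×ˢ Set.univ) →
      (∀ s t : ℝ, s < t → t < 0 → ∀ x, v t x =
        Literature.Analysis.UnboundedOperators.heatExtension (v s) (t - s) x -
          Literature.Analysis.FluidPDE.oseenDuhamel 1 s v v t x) →
      (∀ t < 0, Literature.Analysis.FluidPDE.VectorCalculus.IsDivFree (v t)) →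
      (∀ s < 0, ∀ y, ⟪Literature.Analysis.FluidPDE.curl (v s) y, EuclideanSpace.single 2 1⟫_ℝ = 0) →
      v (-1) 0 2 ≠ 0 → (∀ t < 0, ∀ x, Real.sqrt (-t) * |v t x 2| ≤ |v (-1) 0 2|) →
      (∀ h : EuclideanSpace ℝ (Fin 3), fderiv ℝ (v (-1)) 0 h 2 = 0) →
      (deriv (fun s => v s 0 2) (-1) = v (-1) 0 2 / 2 ∧ v (-1) 0 2 * (Δ (fun y => v (-1) y 2)) 0 ≤ 0) →
      (∃ δ : ℝ, 0 < δ ∧ ∀ y : EuclideanSpace ℝ (Fin 3), y 2 = 0 → y ≠ 0 → ‖y‖ < δ →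
          (fderiv ℝ (v (-1)) y (EuclideanSpace.single 0 1) 2 ≠ 0 ∨ fderiv ℝ (v (-1)) y (EuclideanSpace.single 1 1) 2 ≠ 0)) →
      ∀ W : Set (ℝ × EuclideanSpace ℝ (Fin 3)), IsOpen W → W ⊆ Set.Iio (0 : ℝ) ×ˢ Set.univ →
        (∀ z ∈ W, (Literature.Analysis.FluidPDE.curl (v z.1) z.2 ≠ 0 ∧
            (fderiv ℝ (v z.1) z.2 (EuclideanSpace.single 0 1) 2 ≠ 0 ∨ fderiv ℝ (v z.1) z.2 (EuclideanSpace.single 1 1) 2 ≠ 0) ∧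
            (fderiv ℝ (v z.1) z.2 (EuclideanSpace.single 2 1) 0 ≠ 0 ∨ fderiv ℝ (v z.1) z.2 (EuclideanSpace.single 2 1) 1 ≠ 0)) ∧
          (fderiv ℝ (fun x => fderiv ℝ (v z.1) x (EuclideanSpace.single 2 1) 2) z.2 (EuclideanSpace.single 0 1) *
                fderiv ℝ (v z.1) z.2 (EuclideanSpace.single 1 1) 2 -
              fderiv ℝ (fun x => fderiv ℝ (v z.1) x (EuclideanSpace.single 2 1) 2) z.2 (EuclideanSpace.single 1 1) *
                fderiv ℝ (v z.1) z.2 (EuclideanSpace.single 0 1) 2 ≠ 0)) →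
        (∀ m : ℝ → ℝ → ℝ, ∀ W₁ : Set (ℝ × EuclideanSpace ℝ (Fin 3)), W₁ ⊆ W → IsOpen W₁ → W₁.Nonempty →
            ∃ z ∈ W₁, ∃ b : Fin 3, b ≠ 2 ∧
              fderiv ℝ (v z.1) z.2 (EuclideanSpace.single 2 1) b ≠
                m z.1 (z.2 2) * fderiv ℝ (v z.1) z.2 (EuclideanSpace.single b 1) 2) →
        (∀ r : ℝ, 0 < r → (Metric.ball ((-1 : ℝ), (0 : EuclideanSpace ℝ (Fin 3))) r ∩ W).Nonempty) →
        False := by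
  sorry

/-- **STUB I3 (residue on a NEW OBJECT): NO HOT ARC.**  `stub_threadedThickEmpty` VERBATIM plus the second curve-selection alternative: a continuous
injective half-arc `Γ = γ([0,∞))` in the hot spot's plane, issuing from the hot spot, along which `v₂(−1,·) ≡ v₂(−1,0)` — every point of `Γ` is a
hot spot (all pins of `…ThreadPins`, `…ThreadPressure`, `…ThreadSpaceTimePin` hold along `Γ`).  Structure to use: near `Γ` the leaves are open bands
flanking `Γ` (no closed leaf: the disc-moment engine of `stub_isolatedThreadEmpty` is void here, which is why this is a separate statement); `Γ` is a
horizontal vortex line or a zero of `ω`; in Fermi coordinates `(σ,n)` the flanking twist is `−2a^{3/2}n²∂_σ(b/√a) + O(n³)`, `a = −½D²v₂[ν,ν] ≥ 0`,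
`b = D²v₂[ν,e₂]`, `b² ≤ 2a(−∂_z²v₂)` (signed Hessian pin), so thick twisting windows accumulate at the thread iff `b/√a` is not locally constant
along `Γ`; if `Γ` is unbounded, recentring along it (tree compactness `…ExtremalThread`) keeps an arc of hot spots through the new origin.  The arc
interpolates between the isolated thread and stratum (A) (a full LINE of hot spots; no thick twisting member, STRATUM-A-K2p4 THEOREM A-THICK).
Why it might fail: an arc of simultaneous maxima is infinite-codimension but not excluded by any identity in the tree; a K-48-type kinematic
witness with a line of maxima may exist outside (M) (ask the disprover; (M) kept). -/
theorem stub_hotArcEmpty :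
    ∀ (C : ℝ) (v : ℝ → EuclideanSpace ℝ (Fin 3) → EuclideanSpace ℝ (Fin 3)),
      Literature.Analysis.FluidPDE.HasTypeITimeDecay C v →
      ContinuousOn (Function.uncurry v) (Set.Iio (0 : ℝ) ×ˢ Set.univ) →
      (∀ s t : ℝ, s < t → t < 0 → ∀ x, v t x =
        Literature.Analysis.UnboundedOperators.heatExtension (v s) (t - s) x -
          Literature.Analysis.FluidPDE.oseenDuhamel 1 s v v t x) →
      (∀ t < 0, Literature.Analysis.FluidPDE.VectorCalculus.IsDivFree (v t)) →
      (∀ s < 0, ∀ y, ⟪Literature.Analysis.FluidPDE.curl (v s) y, EuclideanSpace.single 2 1⟫_ℝ = 0) →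
      v (-1) 0 2 ≠ 0 → (∀ t < 0, ∀ x, Real.sqrt (-t) * |v t x 2| ≤ |v (-1) 0 2|) →
      (∀ h : EuclideanSpace ℝ (Fin 3), fderiv ℝ (v (-1)) 0 h 2 = 0) →
      (deriv (fun s => v s 0 2) (-1) = v (-1) 0 2 / 2 ∧ v (-1) 0 2 * (Δ (fun y => v (-1) y 2)) 0 ≤ 0) →
      (∃ γ : ℝ → EuclideanSpace ℝ (Fin 3), ContinuousOn γ (Set.Ici 0) ∧ Set.InjOn γ (Set.Ici 0) ∧ γ 0 = 0 ∧
          ∀ σ : ℝ, 0 ≤ σ → (γ σ 2 = 0 ∧ v (-1) (γ σ) 2 = v (-1) 0 2)) →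
      ∀ W : Set (ℝ × EuclideanSpace ℝ (Fin 3)), IsOpen W → W ⊆ Set.Iio (0 : ℝ) ×ˢ Set.univ →
        (∀ z ∈ W, (Literature.Analysis.FluidPDE.curl (v z.1) z.2 ≠ 0 ∧
            (fderiv ℝ (v z.1) z.2 (EuclideanSpace.single 0 1) 2 ≠ 0 ∨ fderiv ℝ (v z.1) z.2 (EuclideanSpace.single 1 1) 2 ≠ 0) ∧
            (fderiv ℝ (v z.1) z.2 (EuclideanSpace.single 2 1) 0 ≠ 0 ∨ fderiv ℝ (v z.1) z.2 (EuclideanSpace.single 2 1) 1 ≠ 0)) ∧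
          (fderiv ℝ (fun x => fderiv ℝ (v z.1) x (EuclideanSpace.single 2 1) 2) z.2 (EuclideanSpace.single 0 1) *
                fderiv ℝ (v z.1) z.2 (EuclideanSpace.single 1 1) 2 -
              fderiv ℝ (fun x => fderiv ℝ (v z.1) x (EuclideanSpace.single 2 1) 2) z.2 (EuclideanSpace.single 1 1) *
                fderiv ℝ (v z.1) z.2 (EuclideanSpace.single 0 1) 2 ≠ 0)) →
        (∀ m : ℝ → ℝ → ℝ, ∀ W₁ : Set (ℝ × EuclideanSpace ℝ (Fin 3)), W₁ ⊆ W → IsOpen W₁ → W₁.Nonempty →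
            ∃ z ∈ W₁, ∃ b : Fin 3, b ≠ 2 ∧
              fderiv ℝ (v z.1) z.2 (EuclideanSpace.single 2 1) b ≠
                m z.1 (z.2 2) * fderiv ℝ (v z.1) z.2 (EuclideanSpace.single b 1) 2) →
        (∀ r : ℝ, 0 < r → (Metric.ball ((-1 : ℝ), (0 : EuclideanSpace ℝ (Fin 3))) r ∩ W).Nonempty) →
        False := by
  sorry

/-! ## Composition (kernel-checked; no sorry below this line) -/

/-- **S3 `stub_threadedThickEmpty` (twist_split v5 / far_thread v4, VERBATIM statement) from the three stubs, by cases on the curve-selection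
alternative at the hot spot.** -/
theorem threadedThickEmpty_of_isolatedThread :
    ∀ (C : ℝ) (v : ℝ → EuclideanSpace ℝ (Fin 3) → EuclideanSpace ℝ (Fin 3)),
      Literature.Analysis.FluidPDE.HasTypeITimeDecay C v →
      ContinuousOn (Function.uncurry v) (Set.Iio (0 : ℝ) ×ˢ Set.univ) →
      (∀ s t : ℝ, s < t → t < 0 → ∀ x, v t x =
        Literature.Analysis.UnboundedOperators.heatExtension (v s) (t - s) x -
          Literature.Analysis.FluidPDE.oseenDuhamel 1 s v v t x) →
      (∀ t < 0, Literature.Analysis.FluidPDE.VectorCalculus.IsDivFree (v t)) →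
      (∀ s < 0, ∀ y, ⟪Literature.Analysis.FluidPDE.curl (v s) y, EuclideanSpace.single 2 1⟫_ℝ = 0) →
      v (-1) 0 2 ≠ 0 → (∀ t < 0, ∀ x, Real.sqrt (-t) * |v t x 2| ≤ |v (-1) 0 2|) →
      (∀ h : EuclideanSpace ℝ (Fin 3), fderiv ℝ (v (-1)) 0 h 2 = 0) →
      (deriv (fun s => v s 0 2) (-1) = v (-1) 0 2 / 2 ∧ v (-1) 0 2 * (Δ (fun y => v (-1) y 2)) 0 ≤ 0) →
      ∀ W : Set (ℝ × EuclideanSpace ℝ (Fin 3)), IsOpen W → W ⊆ Set.Iio (0 : ℝ) ×ˢ Set.univ →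
        (∀ z ∈ W, (Literature.Analysis.FluidPDE.curl (v z.1) z.2 ≠ 0 ∧
            (fderiv ℝ (v z.1) z.2 (EuclideanSpace.single 0 1) 2 ≠ 0 ∨ fderiv ℝ (v z.1) z.2 (EuclideanSpace.single 1 1) 2 ≠ 0) ∧
            (fderiv ℝ (v z.1) z.2 (EuclideanSpace.single 2 1) 0 ≠ 0 ∨ fderiv ℝ (v z.1) z.2 (EuclideanSpace.single 2 1) 1 ≠ 0)) ∧
          (fderiv ℝ (fun x => fderiv ℝ (v z.1) x (EuclideanSpace.single 2 1) 2) z.2 (EuclideanSpace.single 0 1) *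
                fderiv ℝ (v z.1) z.2 (EuclideanSpace.single 1 1) 2 -
              fderiv ℝ (fun x => fderiv ℝ (v z.1) x (EuclideanSpace.single 2 1) 2) z.2 (EuclideanSpace.single 1 1) *
                fderiv ℝ (v z.1) z.2 (EuclideanSpace.single 0 1) 2 ≠ 0)) →
        (∀ m : ℝ → ℝ → ℝ, ∀ W₁ : Set (ℝ × EuclideanSpace ℝ (Fin 3)), W₁ ⊆ W → IsOpen W₁ → W₁.Nonempty →
            ∃ z ∈ W₁, ∃ b : Fin 3, b ≠ 2 ∧
              fderiv ℝ (v z.1) z.2 (EuclideanSpace.single 2 1) b ≠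
                m z.1 (z.2 2) * fderiv ℝ (v z.1) z.2 (EuclideanSpace.single b 1) 2) →
        (∀ r : ℝ, 0 < r → (Metric.ball ((-1 : ℝ), (0 : EuclideanSpace ℝ (Fin 3))) r ∩ W).Nonempty) →
        False := by
  intro C v hrate hcont hmild hdiv hpol hV hsup hgrad hpins W hWo hWs hW hnTH hacc
  rcases stub_threadCurveSelection C v hrate hcont hmild hdiv hpol hV hsup with hiso | harc
  · exact stub_isolatedThreadEmpty C v hrate hcont hmild hdiv hpol hV hsup hgrad hpins hiso W hWo hWs hW hnTH hacc
  · exact stub_hotArcEmpty C v hrate hcont hmild hdiv hpol hV hsup hgrad hpins harc W hWo hWs hW hnTH hacc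

/-- **The item `LrcModEntire` (stmt-NavierStokesRegularity-20428) BY NAME** — tree p633507 `…FarThreadReduction.lrcModEntire_of_NUGRS_of_threadedThick`
applied to the shared (TH) stub and the composed S3. -/
theorem LrcModEntire_of_isolatedThread :
    Summit.NavierStokesRegularity.NavierStokesRegularity.Theses.PoloidalWindowDoor.LrcModEntire :=
  lrcModEntire_of_NUGRS_of_threadedThick stub_localTHEmptyHypNUGRS threadedThickEmpty_of_isolatedThread

/-- **The crux `PoloidalWindowRigidity` (K2, stmt-NavierStokesRegularity-19708) BY NAME** — tree `…FarThreadReduction.poloidalWindowRigidity_of_TH_of_threadedThick`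
with the (TH)∩twisting germ statement obtained from the shared v4.3 local stub through the tree chain (`…NormalFormRS` → `…Galilean` → `…NonUmbilic`
→ `…HypGerm.stub_twistingTH_of_localEmptyHyp`) and the composed S3. -/
theorem PoloidalWindowRigidity_of_isolatedThread :
    Summit.NavierStokesRegularity.NavierStokesRegularity.Theses.PoloidalWindowDoor.PoloidalWindowRigidity :=
  poloidalWindowRigidity_of_TH_of_threadedThick
    (stub_twistingTH_of_localEmptyHyp
      (localTHEmptyHyp_of_localTHEmptyHypNonUmbilic
        (localTHEmptyHypNonUmbilic_of_galilean (localTHEmptyHypNF_of_normalFormRS stub_localTHEmptyHypNUGRS))))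
    threadedThickEmpty_of_isolatedThread

end Summit.NavierStokesRegularity.NavierStokesRegularity.Cruxes.PoloidalWindowRigidity.IsolatedThread
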